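import Literature.NumberTheory.LFunctions.UniformWeilPositivityRH
import Literature.NumberTheory.LFunctions.GeneralizedRH
import Literature.NumberTheory.LFunctions.MiscArithmeticRHEquivalents
import Literature.NumberTheory.LFunctions.ZetaRealAxis
import Literature.NumberTheory.LFunctions.EntireZeroSum
import Literature.NumberTheory.DiophantineGeometry.NamedHypothesesRHProofs
import Literature.NumberTheory.DiophantineGeometry.NamedHypothesesProofs
import Literature.NumberTheory.LFunctions.WeilCriterionConverse
import HarnessLib

/-!
# RiemannHypothesis / Splittings — ORDINATE detectors: `RH ⟺ im is injective on the non-trivial zeros`; LI over the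
zero SET is through-RH (RAW zero-def form of cell rh-split, seat (weil, bridge) gen 3, card `cards/SPLIT-weil-bridge.md` §9 P5)

Raw §1 of `HOME/rh-split-weil-bridge/SketchG3.lean` (sha16 faddac67f74cb8d9; referee g2 00:38Z: §9 DELIVERABLE, these
detectors content pre-file PASS; typer-2 g2 H1), filed by rh-split-typer-2 g2.  RH is the statement «no two distinct
non-trivial zeros share an ordinate» (mirror pair `ρ ↦ 1 − conj ρ`): `rh_iff_injOn_im`; the upper-half form
`rh_of_injOn_im_upper`; hence the Linear Independence hypothesis stated over the zero SET forces RH outright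
(`rh_of_linearIndependent_im`) — as a «bridge» it is decoration (THROUGH-RH), while plain simplicity forces nothing.
DEDUP note: the tree's `CostumeDetectorsHeight.rh_of_ordinateInjective101` (typer-2 g0) is the stronger F1-free TAIL form
(injectivity only above height 101 suffices); this file adds the `↔`, the `InjOn`/upper-half spelling over Mathlib's
`nontrivialZeros riemannZeta`, and the LI corollary; gate dedup: the mirror lemmas are CITED from the tree
(`WeilConverse.one_sub_conj_im`; the unused `1 − conj ρ ≠ ρ` lemma is the tree's `PairCorrelationOffLineDensity.reflection_ne`).  Theorems only.
SPLITTING SEARCH over kernel-typed RH-EQUIVALENCES; a splitting A ∧ B ⟹ RH is CONDITIONAL bookkeeping unless A and B are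
both proved; nothing here bears on the truth of RH.
-/

noncomputable section

open Set Complex
open scoped ComplexConjugate
open Literature.NumberTheory.LFunctions Literature.NumberTheory.LFunctions.EntireEF
open Literature.NumberTheory.DiophantineGeometry

set_option linter.dupNamespace false


namespace Summit.RiemannHypothesis.RiemannHypothesis.Theorems.Splittings.OrdinateDetectors

/-- The strip form of RH, as an `↔` usable by `rw` (tree `riemannHypothesis_iff_strip_holds`). [tree theorem] -/
theorem rh_iff_strip' :
    _root_.RiemannHypothesis ↔ ∀ s : ℂ, riemannZeta s = 0 → 0 < s.re → s.re < 1 → s.re = 1 / 2 :=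
  riemannHypothesis_iff_strip_holds

/-! ## §1 The ordinate detector: RH ⟺ ordinate-injectivity on the non-trivial zeros -/

/-- The mirror `1 − conj ρ` of a non-trivial zero is a non-trivial zero (conjugation + functional equation).
[folklore] -/
theorem mirror_mem {ρ : ℂ} (h : ρ ∈ nontrivialZeros riemannZeta) :
    1 - conj ρ ∈ nontrivialZeros riemannZeta := by
  obtain ⟨hz, h0, h1⟩ := h
  refine ⟨?_, ?_, ?_⟩
  · exact riemannZeta_one_sub_eq_zero (by simpa using h0) (by simpa using h1) (riemannZeta_conj_eq_zero hz)
  · simp; linarith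
  · simp; linarith

/-- **Ordinate detector.** If `im` is injective on the non-trivial zeros then RH holds (the mirror pair
`ρ, 1 − conj ρ` shares its ordinate). RH-free, hypothesis-free. [new] -/
theorem rh_of_injOn_im (h : Set.InjOn Complex.im (nontrivialZeros riemannZeta)) : _root_.RiemannHypothesis := by
  refine rh_iff_strip'.2 fun s hs h0 h1 => ?_
  have hs' : s ∈ nontrivialZeros riemannZeta := ⟨hs, h0, h1⟩
  have he : 1 - conj s = s := h (mirror_mem hs') hs' (Literature.NumberTheory.LFunctions.WeilConverse.one_sub_conj_im s)
  have := congrArg Complex.re he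
  simp at this
  linarith

/-- Converse: under RH two non-trivial zeros with the same ordinate coincide. [folklore] -/
theorem injOn_im_of_rh (h : _root_.RiemannHypothesis) : Set.InjOn Complex.im (nontrivialZeros riemannZeta) := by
  intro s hs t ht hi
  have hs2 : s.re = 1 / 2 := rh_iff_strip'.1 h s hs.1 hs.2.1 hs.2.2
  have ht2 : t.re = 1 / 2 := rh_iff_strip'.1 h t ht.1 ht.2.1 ht.2.2
  exact Complex.ext (by rw [hs2, ht2]) hi

/-- **RH ⟺ no two distinct non-trivial zeros share an ordinate.** [new] -/
theorem rh_iff_injOn_im : _root_.RiemannHypothesis ↔ Set.InjOn Complex.im (nontrivialZeros riemannZeta) :=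
  ⟨injOn_im_of_rh, rh_of_injOn_im⟩

/-- Upper-half version: injectivity of `im` on the zeros with `im ρ > 0` already gives RH (lower zeros by
conjugation, real zeros excluded by `im_ne_zero_of_riemannZeta_eq_zero`). [new] -/
theorem rh_of_injOn_im_upper
    (h : Set.InjOn Complex.im (nontrivialZeros riemannZeta ∩ {z | 0 < z.im})) : _root_.RiemannHypothesis := by
  refine rh_iff_strip'.2 fun s hs h0 h1 => ?_
  have key : ∀ t : ℂ, t ∈ nontrivialZeros riemannZeta → 0 < t.im → t.re = 1 / 2 := by
    intro t ht htim
    have he : 1 - conj t = t :=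
      h ⟨mirror_mem ht, by simpa [Literature.NumberTheory.LFunctions.WeilConverse.one_sub_conj_im] using htim⟩ ⟨ht, htim⟩ (Literature.NumberTheory.LFunctions.WeilConverse.one_sub_conj_im t)
    have := congrArg Complex.re he
    simp at this
    linarith
  have hs' : s ∈ nontrivialZeros riemannZeta := ⟨hs, h0, h1⟩
  rcases lt_trichotomy 0 s.im with hpos | hzero | hneg
  · exact key s hs' hpos
  · exact absurd hzero.symm (im_ne_zero_of_riemannZeta_eq_zero hs h0 h1)
  · have hc : conj s ∈ nontrivialZeros riemannZeta :=
      ⟨riemannZeta_conj_eq_zero hs, by simpa using h0, by simpa using h1⟩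
    have := key (conj s) hc (by simpa using hneg)
    simpa using this

/-- **LI over the zero SET is through-RH.** Linear independence over `ℚ` of the positive ordinates, indexed by
the zero set itself, forces `im` to be injective there, hence RH (so, as a «bridge», it is decoration; the
multiset form of LI presupposes simplicity and says the same). [new] -/
theorem rh_of_linearIndependent_im
    (h : LinearIndependent ℚ (fun ρ : ↥(nontrivialZeros riemannZeta ∩ {z | 0 < z.im}) => (ρ : ℂ).im)) :
    _root_.RiemannHypothesis := by
  refine rh_of_injOn_im_upper ?_
  intro s hs t ht hi
  have := h.injective (a₁ := ⟨s, hs⟩) (a₂ := ⟨t, ht⟩) (by simpa using hi)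
  simpa using congrArg Subtype.val this

end Summit.RiemannHypothesis.RiemannHypothesis.Theorems.Splittings.OrdinateDetectors

end
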